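import Summits.QuantumFields.BalabanUV.Beta.D1BFx.TorusGaugeBasis

/-!
# `BalabanUV.Beta.D1BFx.TorusGaugeBasisTranspose` — road «BF-x», binder row D1, slot (K), X₃(ii) ROUTE T: **THE TRANSPOSED WARD LETTER (a0t)
# ON THE TORUS, `K̂ᵀ·Ŵ₀ = 0`**, via **`K̂ᵀ = K̂`**

WHY.  K-TA4G (R2) (`GramWeightDeterminant.det_kkt_add_weight_slice` ∕ `…_gram` ∕ `absDet_gramTransfer_coframe`, `GramWeightJets.secondVar_gramTransfer_jets`,
the `SliceTransfer*` chain) takes, besides the Ward letters (a0) `K·W = 0` and (b0) `Q·W = 0`, the transposed letter **`hKtW : Kᵀ·W = 0`**.  On the torus, K-TB3b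
FILE 1 PART 1 (`TorusGaugeBasis`, p239910) supplies (a0) `Khat_mul_What0`, (b0) `Qhat_mul_What0` and `hτ` `isUnit_det_tauT_mul_What0`; the road owner's ZEROTH-ORDER
JUNCTION note (journal l.23059) lists the one remaining zeroth-order letter: «+ `Khatᵀ = Khat` for (a0t), 10 lines, any seat».  This module is those lines (first
kernel-checked as probe P3 of the outside read C-ne7bleaf01g21-1 of p239910).
CONTENT ([folklore]; every `d`, block side `n ≥ 1`, coarse period `p ≥ 1`, in-block root `toSite r` where marked):
* `trF_fTL_sortK_bhK : trF (fTL (sortK n bhK)) = fTL (sortK n bhK)` — the ff block of the sorted bordered Hessian is symmetric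
  (`BorderedHessianSymmetry.trK_bhK : trK bhK = sgnK bhK` with `sgnF = +1` on field legs);
* **`Khat_transpose : K̂ᵀ = K̂`** (`SortedKernels.periodiseF_trF` with `TorusCombKKT.isPeriodic₂_sortK_bhK`), `isSymm_Khat`;
* **`Khat_transpose_mul_What0 (hr) : K̂ᵀ·Ŵ₀ = 0`** — the letter (a0t) = `hKtW` of K-TA4G at `(K, W) := (K̂, Ŵ₀)` (⟸ `Khat_transpose` + (a0)).
NOT HERE: anything of PART 2 (`Nhat`, `What0 = ĝrad·Nhat`), of FILE 2 ∕ the junction (`TorusGaugeWeight`, `TorusZerothJunction`), or of the jets.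

HONEST FRAMING (cell contract, verbatim): «discharging `BetaPertH` makes Bałaban's UV stability UNCONDITIONAL — a real constructive-QFT result; it
is NOT the continuum limit and NOT the Clay problem.»  HONEST DEPENDENCY (verbatim): «continuum YM on T⁴ ⇐ BetaPertH ∧ nine spine estimates (0/9
proved); BetaPertH ⇐ (D1) ∧ (D4) ∧ CAP+tail; G-an2-4 gates asym, D1 and NE2/3/4.»  [folklore] finite linear algebra BY NAME over tree objects; no definition,
no `def … : Prop`, nothing cited, no wall binder instantiated; 0 sorry.  0∕4 row-D1 binders; (K) NOT closed; NOT D1, NOT BetaPertH, NOT continuum, NOT Clay.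
ABSOLUTE RULE (cell, verbatim): «No internally-minted statement may enter as a cited fact. Every hypothesis is either kernel-proved in this package or a
verbatim quotation of a PUBLISHED theorem with page reference. The manuscript(s) under audit are NOT citable for their own disputed steps — they are the
thing under adjudication; programme-internal (2001/route/tribunal) claims are never citable.»
Provenance: T⁴ NE7b formalisation swarm leaf seat `b2b-balaban-t4-ne7b-formalise-leaf-01` (gen 21) on cross-cell duty, answering the road owner's open call
l.23059; 2026-08-20.
-/

noncomputable section

namespace Summit.QuantumFields.BalabanUV.Beta.D1BFx.TorusGaugeBasisTranspose

open Matrix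
open Literature.MathematicalPhysics.QuantumFieldTheory.Balaban1983to89.Beta
open AffineAveraging (box toSite)
open Summit.QuantumFields.BalabanUV.Beta.TameKernelCalculus (trK trK_apply)
open Summit.QuantumFields.BalabanUV.Beta.BorderedHessian (bhK sgnK_apply sgnF_inl trK_bhK)
open Summit.QuantumFields.BalabanUV.Beta.D1BFx.FibredPeriodisation
open Summit.QuantumFields.BalabanUV.Beta.D1BFx.SortedKernels
open Summit.QuantumFields.BalabanUV.Beta.D1BFx.SortedReblocking (finePt)
open Summit.QuantumFields.BalabanUV.Beta.D1BFx.SortedPack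
open Summit.QuantumFields.BalabanUV.Beta.D1BFx.TorusCombKKT (Khat isPeriodic₂_sortK_bhK)
open Summit.QuantumFields.BalabanUV.Beta.D1BFx.TorusGaugeBasis (What0 Khat_mul_What0)

variable {d : ℕ} (r : Fin (d + 1) → ℕ) (n p : ℕ) [NeZero n] [NeZero p]

/-- [folklore] **The ff block of the sorted bordered Hessian is symmetric**: `trF (fTL (sortK n bhK)) = fTL (sortK n bhK)` — entrywise
`bhK y x (inl b) (inl a) = bhK x y (inl a) (inl b)`, from `trK bhK = sgnK bhK` with `sgnF (inl _) = 1`. -/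
theorem trF_fTL_sortK_bhK : trF (fTL (sortK n (bhK (d := d) n))) = fTL (sortK n (bhK (d := d) n)) := by
  funext ⟨x, z, a⟩ ⟨y, z', b⟩
  show sortK n (bhK (d := d) n) (y, Sum.inl (z', b)) (x, Sum.inl (z, a)) = sortK n (bhK (d := d) n) (x, Sum.inl (z, a)) (y, Sum.inl (z', b))
  rw [sortK_inl_inl, sortK_inl_inl]
  have h := congrFun (congrFun (congrFun (congrFun (trK_bhK (d := d) n) (finePt n x z)) (finePt n y z')) (Sum.inl a)) (Sum.inl b)
  rw [trK_apply, sgnK_apply, sgnF_inl, sgnF_inl, one_mul, one_mul] at h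
  exact h

/-- [folklore] **`K̂ᵀ = K̂`**: the torus curvature block `K̂ = (fTL (sortK n bhK))^` is symmetric (`periodiseF_trF` on jointly periodic fibres + `trF_fTL_sortK_bhK`). -/
theorem Khat_transpose : (Khat (d := d) n p)ᵀ = Khat (d := d) n p := by
  rw [Khat, ← periodiseF_trF (fun a b => isPeriodic₂_sortK_bhK n p (Sum.inl a) (Sum.inl b)), trF_fTL_sortK_bhK]

/-- [folklore] `K̂` is symmetric, in Mathlib's `Matrix.IsSymm` currency. -/
theorem isSymm_Khat : (Khat (d := d) n p).IsSymm := Khat_transpose n p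

/-- [folklore] **THE TRANSPOSED WARD LETTER (a0t) ON THE TORUS: `K̂ᵀ·Ŵ₀ = 0`** — the `hKtW` slot of K-TA4G (R2) at `(K, W) := (K̂, Ŵ₀)`
(in-block root, as for (a0)). -/
theorem Khat_transpose_mul_What0 (hr : r ∈ box (d + 1) n) : (Khat (d := d) n p)ᵀ * What0 r n p = 0 := by
  rw [Khat_transpose, Khat_mul_What0 r n p hr]

end Summit.QuantumFields.BalabanUV.Beta.D1BFx.TorusGaugeBasisTranspose

end
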